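import Summits.QuantumFields.YangMills.Theorems.EquipartitionCriticalityEquipartitionPinsProbeTangentDefs
import Summits.QuantumFields.YangMills.Theorems.EquipartitionCriticalityEquipartitionPinsProbeTangentLieFrame
import Summits.QuantumFields.YangMills.Theorems.EquipartitionCriticalityEquipartitionPinsProbeTangentCombPoincare
import HarnessLib

/-!
# Tangent energy algebra: the linearised curl against the plaquette deviation

Crux `stmt-QuantumFields-8760` (`EquipartitionPinsProbe`), line `Sketch`, stub `stub_energyAlgebra` (TA)
of the reshaped `stub_tangentCore`.

For a lattice representation `r` (unitary `ρ`, `N = r.N`), a configuration `U` on `ℤ⁴` in the comb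
gauge `Ũ = axialFix U`, a plaquette `p` with boundary links `V_i = ρ(Ũ_{∂_i p})`, `i = 0, …, 3`
(`plaquetteBoundary p = ((x,i), (x+eᵢ,j), (x+eⱼ,i), (x,j))`), so that by the very definition of
`plaquetteHolonomyZd` and `ρ(g⁻¹) = ρ(g)†` one has `ρ(Ũ_p) = V₀ V₁ V₂† V₃†`, the Frobenius
coordinates `c(M) = lieCoord r M a = Re tr(M e_a†)` satisfy, uniformly in `U, p, a`,

`|c(V₀−1) + c(V₁−1) − c(V₂−1) − c(V₃−1) − c(ρ(Ũ_p) − 1)| ≤ 3 ∑_i (N − Re tr V_i)`.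

Pure matrix algebra:

* `e_a` is skew-Hermitian (`FreeEnergyLogCoefficient.conjTranspose_lieIso`), so `−c(V−1) = c(V†−1)`,
  and `c` is real-linear, so the left side is `|c(R)|` with `R = W₀W₁W₂W₃ − 1 − ∑ (W_i − 1)`,
  `W = (V₀, V₁, V₂†, V₃†)`;
* the telescoping identity `R = (W₀−1)(W₁−1) + (W₀W₁−1)(W₂−1) + (W₀W₁W₂−1)(W₃−1)`;
* `|c(R)| ≤ ‖R‖_F` (Cauchy–Schwarz in the tree's `frobeniusInnerProductSpace`, `‖e_a‖_F = 1`),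
  `‖AB‖_F ≤ ‖A‖_F ‖B‖_F`, `‖VW − 1‖_F ≤ ‖V − 1‖_F + ‖W − 1‖_F` for unitary `V`
  (`TangentCombPoincare.norm_mul_sub_one_le`), and `‖V−1‖_F² = ‖V†−1‖_F² = 2(N − Re tr V)` for
  unitary `V` (`TangentCombPoincare.norm_sub_one_sq`);
* finally `∑_{i<j} x_i x_j ≤ ∑_{i<j} (x_i² + x_j²)/2 = 3 ∑_i (N − Re tr V_i)`.

No probability and no lattice geometry beyond the two definitions `plaquetteCurl_eq`,
`plaquetteHolonomyZd` enter.
-/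

noncomputable section

open scoped Matrix Matrix.Norms.Frobenius
open Literature.MathematicalPhysics.QuantumLattice Literature.MathematicalPhysics.QuantumFieldTheory

namespace Summit.QuantumFields.YangMills.Theorems.EquipartitionPinsProbe

namespace TangentEnergyAlgebra

/-! ### Frobenius-norm facts -/

section MatrixFacts

variable {N : ℕ}

/-- For unitary `V`: `‖V† − 1‖_F² = 2 (N − Re tr V)`. -/
theorem norm_conjTranspose_sub_one_sq {V : Matrix (Fin N) (Fin N) ℂ}
    (hV : V ∈ Matrix.unitaryGroup (Fin N) ℂ) : ‖Vᴴ - 1‖ ^ 2 = 2 * ((N : ℝ) - V.trace.re) := by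
  have h : Vᴴ - 1 = (V - 1)ᴴ := by rw [Matrix.conjTranspose_sub, Matrix.conjTranspose_one]
  rw [h, Matrix.frobenius_norm_conjTranspose, TangentCombPoincare.norm_sub_one_sq hV]

/-- The telescoping expansion of a fourfold product around the identity:
`∑ (W_i − 1) − (W₀W₁W₂W₃ − 1) = −[(W₀−1)(W₁−1) + (W₀W₁−1)(W₂−1) + (W₀W₁W₂−1)(W₃−1)]`. -/
theorem sum_sub_prod_four (W₀ W₁ W₂ W₃ : Matrix (Fin N) (Fin N) ℂ) :
    (W₀ - 1) + (W₁ - 1) + (W₂ - 1) + (W₃ - 1) - (W₀ * W₁ * W₂ * W₃ - 1) =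
      -((W₀ - 1) * (W₁ - 1) + (W₀ * W₁ - 1) * (W₂ - 1) + (W₀ * W₁ * W₂ - 1) * (W₃ - 1)) := by
  noncomm_ring

/-- Frobenius bound of the telescoping remainder by the distances of the factors to `1`
(`W₀, W₁` unitary). -/
theorem norm_remainder_le {W₀ W₁ : Matrix (Fin N) (Fin N) ℂ} (h₀ : W₀ ∈ Matrix.unitaryGroup (Fin N) ℂ)
    (h₁ : W₁ ∈ Matrix.unitaryGroup (Fin N) ℂ) (W₂ W₃ : Matrix (Fin N) (Fin N) ℂ) :
    ‖(W₀ - 1) * (W₁ - 1) + (W₀ * W₁ - 1) * (W₂ - 1) + (W₀ * W₁ * W₂ - 1) * (W₃ - 1)‖ ≤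
      ‖W₀ - 1‖ * ‖W₁ - 1‖ + (‖W₀ - 1‖ + ‖W₁ - 1‖) * ‖W₂ - 1‖ +
        (‖W₀ - 1‖ + ‖W₁ - 1‖ + ‖W₂ - 1‖) * ‖W₃ - 1‖ := by
  have h01 : ‖W₀ * W₁ - 1‖ ≤ ‖W₀ - 1‖ + ‖W₁ - 1‖ := TangentCombPoincare.norm_mul_sub_one_le h₀ W₁
  have h012 : ‖W₀ * W₁ * W₂ - 1‖ ≤ ‖W₀ - 1‖ + ‖W₁ - 1‖ + ‖W₂ - 1‖ :=
    (TangentCombPoincare.norm_mul_sub_one_le (mul_mem h₀ h₁) W₂).trans (add_le_add h01 le_rfl)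
  calc ‖(W₀ - 1) * (W₁ - 1) + (W₀ * W₁ - 1) * (W₂ - 1) + (W₀ * W₁ * W₂ - 1) * (W₃ - 1)‖
      ≤ ‖(W₀ - 1) * (W₁ - 1)‖ + ‖(W₀ * W₁ - 1) * (W₂ - 1)‖ + ‖(W₀ * W₁ * W₂ - 1) * (W₃ - 1)‖ :=
        norm_add₃_le
    _ ≤ ‖W₀ - 1‖ * ‖W₁ - 1‖ + ‖W₀ * W₁ - 1‖ * ‖W₂ - 1‖ + ‖W₀ * W₁ * W₂ - 1‖ * ‖W₃ - 1‖ :=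
        add_le_add_three (Matrix.frobenius_norm_mul _ _) (Matrix.frobenius_norm_mul _ _)
          (Matrix.frobenius_norm_mul _ _)
    _ ≤ _ := add_le_add_three le_rfl (mul_le_mul_of_nonneg_right h01 (norm_nonneg _))
        (mul_le_mul_of_nonneg_right h012 (norm_nonneg _))

/-- The elementary real inequality closing the estimate (`x_i² = 2T_i`, and the six cross terms
satisfy `x_i x_j ≤ T_i + T_j`, each index lying in three pairs). -/
theorem real_bound {x₀ x₁ x₂ x₃ T₀ T₁ T₂ T₃ : ℝ} (h₀ : x₀ ^ 2 = 2 * T₀) (h₁ : x₁ ^ 2 = 2 * T₁)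
    (h₂ : x₂ ^ 2 = 2 * T₂) (h₃ : x₃ ^ 2 = 2 * T₃) :
    x₀ * x₁ + (x₀ + x₁) * x₂ + (x₀ + x₁ + x₂) * x₃ ≤ 3 * (T₀ + T₁ + T₂ + T₃) := by
  nlinarith [two_mul_le_add_sq x₀ x₁, two_mul_le_add_sq x₀ x₂, two_mul_le_add_sq x₀ x₃,
    two_mul_le_add_sq x₁ x₂, two_mul_le_add_sq x₁ x₃, two_mul_le_add_sq x₂ x₃]

end MatrixFacts

/-! ### The frame coordinates `lieCoord r · a` -/

section Rep

variable {G : Type} [Group G] [TopologicalSpace G] (r : LatticeRep G)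

/-- Additivity of the frame coordinates in the matrix. -/
theorem lieCoord_add (A B : Matrix (Fin r.N) (Fin r.N) ℂ) (a : Fin (lieDim r)) :
    lieCoord r (A + B) a = lieCoord r A a + lieCoord r B a := by
  simp only [lieCoord, Matrix.add_mul, Matrix.trace_add, Complex.add_re]

/-- The frame coordinates of a difference. -/
theorem lieCoord_sub (A B : Matrix (Fin r.N) (Fin r.N) ℂ) (a : Fin (lieDim r)) :
    lieCoord r (A - B) a = lieCoord r A a - lieCoord r B a := by
  simp only [lieCoord, Matrix.sub_mul, Matrix.trace_sub, Complex.sub_re]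

/-- The frame coordinates of a negative. -/
theorem lieCoord_neg (A : Matrix (Fin r.N) (Fin r.N) ℂ) (a : Fin (lieDim r)) :
    lieCoord r (-A) a = -lieCoord r A a := by
  simp only [lieCoord, Matrix.neg_mul, Matrix.trace_neg, Complex.neg_re]

/-- The frame vectors are Frobenius unit vectors: `‖e_a‖_F = 1`. -/
theorem norm_lieVec (a : Fin (lieDim r)) : ‖lieVec r a‖ = 1 := by
  rw [lieVec, FreeEnergyLogCoefficient.norm_lieIso, PiLp.norm_single, norm_one]

/-- Cauchy–Schwarz: `|lieCoord r M a| = |⟪e_a, M⟫| ≤ ‖M‖_F` (real Hilbert–Schmidt inner product). -/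
theorem abs_lieCoord_le (M : Matrix (Fin r.N) (Fin r.N) ℂ) (a : Fin (lieDim r)) :
    |lieCoord r M a| ≤ ‖M‖ := by
  letI : InnerProductSpace ℝ (Matrix (Fin r.N) (Fin r.N) ℂ) := frobeniusInnerProductSpace
  have h : lieCoord r M a = inner ℝ (lieVec r a) M := by
    rw [lieCoord, frobenius_inner_def, Matrix.trace_mul_comm]
  rw [h]
  exact (abs_real_inner_le_norm _ _).trans_eq (by rw [norm_lieVec, one_mul])

/-- Skew-Hermitian frame: `lieCoord r M† a = −lieCoord r M a`. -/
theorem lieCoord_conjTranspose (M : Matrix (Fin r.N) (Fin r.N) ℂ) (a : Fin (lieDim r)) :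
    lieCoord r Mᴴ a = -lieCoord r M a := by
  have hE : (lieVec r a)ᴴ = -lieVec r a := FreeEnergyLogCoefficient.conjTranspose_lieIso r.ρ _
  simp only [lieCoord]
  rw [← Matrix.conjTranspose_mul, Matrix.trace_conjTranspose, Complex.star_def, Complex.conj_re,
    Matrix.trace_mul_comm (lieVec r a) M, hE, Matrix.mul_neg, Matrix.trace_neg, Complex.neg_re,
    neg_neg]

/-- **The matrix-level estimate**: for unitary `V₀, …, V₃` and `c = lieCoord r · a`,
`|c(V₀−1) + c(V₁−1) − c(V₂−1) − c(V₃−1) − c(V₀V₁V₂†V₃† − 1)| ≤ 3 ∑ (N − Re tr V_i)`. -/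
theorem abs_curl_sub_le (a : Fin (lieDim r)) {V₀ V₁ V₂ V₃ : Matrix (Fin r.N) (Fin r.N) ℂ}
    (h₀ : V₀ ∈ Matrix.unitaryGroup (Fin r.N) ℂ) (h₁ : V₁ ∈ Matrix.unitaryGroup (Fin r.N) ℂ)
    (h₂ : V₂ ∈ Matrix.unitaryGroup (Fin r.N) ℂ) (h₃ : V₃ ∈ Matrix.unitaryGroup (Fin r.N) ℂ) :
    |lieCoord r (V₀ - 1) a + lieCoord r (V₁ - 1) a - lieCoord r (V₂ - 1) a -
          lieCoord r (V₃ - 1) a - lieCoord r (V₀ * V₁ * V₂ᴴ * V₃ᴴ - 1) a| ≤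
      3 * (((r.N : ℝ) - V₀.trace.re) + ((r.N : ℝ) - V₁.trace.re) + ((r.N : ℝ) - V₂.trace.re) +
        ((r.N : ℝ) - V₃.trace.re)) := by
  -- skew-Hermitian frame: `-c(V - 1) = c(V† - 1)`
  have hct : ∀ V : Matrix (Fin r.N) (Fin r.N) ℂ,
      -lieCoord r (V - 1) a = lieCoord r (Vᴴ - 1) a := fun V => by
    rw [← lieCoord_conjTranspose, Matrix.conjTranspose_sub, Matrix.conjTranspose_one]
  rw [sub_eq_add_neg _ (lieCoord r (V₂ - 1) a), sub_eq_add_neg _ (lieCoord r (V₃ - 1) a), hct, hct]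
  -- linearity: the left side is `|c(R)|` for the telescoping remainder `R`
  simp only [← lieCoord_add, ← lieCoord_sub]
  rw [sum_sub_prod_four, lieCoord_neg, abs_neg]
  refine (abs_lieCoord_le r _ a).trans ((norm_remainder_le h₀ h₁ _ _).trans ?_)
  exact real_bound (TangentCombPoincare.norm_sub_one_sq h₀) (TangentCombPoincare.norm_sub_one_sq h₁)
    (norm_conjTranspose_sub_one_sq h₂) (norm_conjTranspose_sub_one_sq h₃)

end Rep

end TangentEnergyAlgebra

/-- STUB TA — **tangent energy algebra**: in the comb gauge `Ũ = axialFix U`, the linearised curl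
`∑_i σ_i c(ρ(Ũ_{∂_i p}) − 1)` of the link deviations differs from the coordinate `c(ρ(Ũ_p) − 1)` of
the plaquette deviation by at most `K ∑_i (N − Re tr ρ(Ũ_{∂_i p}))`, with the absolute constant
`K = 3` (`c = lieCoord r · a`; `ρ(Ũ_p) = V₀V₁V₂†V₃†` by `plaquetteHolonomyZd` and `ρ(g⁻¹) = ρ(g)†`,
then `TangentEnergyAlgebra.abs_curl_sub_le`). -/
theorem stub_energyAlgebra :
    ∀ (G : Type) [Group G] [TopologicalSpace G] (r : Literature.MathematicalPhysics.QuantumFieldTheory.LatticeRep G), ∃ K : ℝ,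
      ∀ (U : Literature.MathematicalPhysics.QuantumLattice.LGConfig 4 G) (p : Literature.MathematicalPhysics.QuantumLattice.ZdPlaquette 4) (a : Fin (Summit.QuantumFields.YangMills.Theorems.EquipartitionPinsProbe.lieDim r)),
        |Literature.MathematicalPhysics.QuantumFieldTheory.plaquetteCurl (fun e => Summit.QuantumFields.YangMills.Theorems.EquipartitionPinsProbe.lieCoord r (r.ρ (Summit.QuantumFields.YangMills.Theorems.EquipartitionPinsProbe.axialFix U e) - 1) a) p -
            Summit.QuantumFields.YangMills.Theorems.EquipartitionPinsProbe.lieCoord r (r.ρ (Literature.MathematicalPhysics.QuantumLattice.plaquetteHolonomyZd (Summit.QuantumFields.YangMills.Theorems.EquipartitionPinsProbe.axialFix U) p.1 p.2.1.1 p.2.1.2) - 1) a| ≤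
          K * ∑ i : Fin 4, ((r.N : ℝ) - (r.ρ (Summit.QuantumFields.YangMills.Theorems.EquipartitionPinsProbe.axialFix U (Literature.MathematicalPhysics.QuantumFieldTheory.plaquetteBoundary p i))).trace.re) := by
  intro G _ _ r
  refine ⟨3, fun U p a => ?_⟩
  simp only [plaquetteCurl_eq, Fin.sum_univ_four, plaquetteBoundary, Matrix.cons_val,
    plaquetteHolonomyZd, map_mul, TangentCombPoincare.map_inv_eq_conjTranspose r.ρ r.mem_unitary]
  exact TangentEnergyAlgebra.abs_curl_sub_le r a (r.mem_unitary _) (r.mem_unitary _)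
    (r.mem_unitary _) (r.mem_unitary _)

end Summit.QuantumFields.YangMills.Theorems.EquipartitionPinsProbe

end
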